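import Literature.Geometry.Riemannian.WarpedSeamMetric
import Literature.Geometry.Riemannian.EmbeddingPieceMetric
import Literature.Geometry.Lorentzian.MetricValCongr
import Literature.Geometry.Manifold.BilinSectionGluing
import Literature.Topology.FourManifolds.Gluing
import HarnessLib

/-!
# Two ingredients of the collar gluing: positivity of the warping factor, disjoint pieces

Support file (everything proved, no definitions, no named facts) for the τ-equivariant collar
gluing (stub `stub_collarGluing` of crux `CorkRegluablePsc`, item stmt-SmoothPoincare4-3206).

* `warpingFactor_pos` — if a Riemannian metric `g` pulls back under a closed collar
  `c : ∂M × [0, 1] ↪ M` to the warped form `ε² ds² + F(x, s) · incl^* g`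
  (Bär–Hanke 2023, §3, Def. 21), then `F > 0`: evaluate on a horizontal vector `(u, 0)`, `u ≠ 0`,
  and use that `c` and `incl` are spacelike (`isSpacelikeImmersion_of_isRiemannian`).
* `exists_pscMetric_of_isEmpty`, `exists_pscMetric_of_disjoint_pieces` — a manifold covered by
  two smoothly embedded compact pieces with DISJOINT images (a gluing along an empty boundary,
  `Literature.Topology.FourManifolds.isBoundaryGluing_interiorSum`) carries a Riemannian metric
  of positive scalar curvature as soon as the pieces do: transport the piece metrics to the two
  open images (`exists_pscMetric_on_openPiece`, O'Neill 1983, Ch. 3, Prop. 3.59) and glue along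
  the open cover (`OpenSubmanifold.exists_pseudoRiemannianMetric_of_openCover`, O'Neill 1983,
  Ch. 2, pp. 36–37).

## References

* B. O'Neill, *Semi-Riemannian Geometry* (1983), Ch. 2, pp. 36–37; Ch. 3, Prop. 3.59; Ch. 4,
  p. 97. [ONeill1983]
* C. Bär, B. Hanke, *Boundary conditions for scalar curvature* (2023), §3, Def. 21. [BarHanke2023]
-/

noncomputable section

open Bundle Set Function Filter TopologicalSpace
open scoped Manifold ContDiff Topology

namespace Literature.Geometry.Riemannian

open Literature.Geometry.Lorentzian Literature.Geometry.Lorentzian.PseudoRiemannianMetric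
  Literature.Topology.FourManifolds Literature.Geometry.Manifold

universe u

/-! ### Positivity of the warping factor -/

section Warping

variable {n : ℕ} {M : Type u} [TopologicalSpace M] [ChartedSpace (EuclideanHalfSpace (n + 1)) M]
  [IsManifold (𝓡∂ (n + 1)) ∞ M] {b : BoundaryData (𝓡∂ (n + 1)) M (𝓡 n)}

/-- **The warping factor of an umbilic collar is positive.** If a Riemannian metric `g` on `M`
pulls back under a closed collar `c` to `ε² V₂ V'₂ + F(x, s) (incl^* g)_x(V₁, V'₁)`, then
`F(x, s) > 0` for all `(x, s) ∈ ∂M × [0, 1]` (`c` and `incl` are spacelike, so both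
`(c^* g)((u,0),(u,0))` and `(incl^* g)(u,u)` are positive for `u ≠ 0`). [cite: ONeill1983, Ch. 4, p. 97] -/
theorem warpingFactor_pos [NeZero n] [Nonempty b.carrier] (c : b.Collar)
    (g : PseudoRiemannianMetric (𝓡∂ (n + 1)) ∞ (EuclideanSpace ℝ (Fin (n + 1)))
      (TangentSpace (𝓡∂ (n + 1)) : M → Type _)) (hg : g.IsRiemannian)
    (F : b.carrier × Set.Icc (0 : ℝ) 1 → ℝ) (ε : ℝ)
    (hc : ∀ (p : b.carrier × Set.Icc (0 : ℝ) 1) (V V' : TangentSpace ((𝓡 n).prod (𝓡∂ 1)) p),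
      pullbackBilin (I := 𝓡∂ (n + 1)) (I' := (𝓡 n).prod (𝓡∂ 1)) c g.val p V V' =
        ε ^ 2 * ((show EuclideanSpace ℝ (Fin 1) from V.2) 0 *
          (show EuclideanSpace ℝ (Fin 1) from V'.2) 0) +
        F p * pullbackBilin (I := 𝓡∂ (n + 1)) (I' := 𝓡 n) b.incl g.val p.1 V.1 V'.1)
    (p : b.carrier × Set.Icc (0 : ℝ) 1) : 0 < F p := by
  haveI : Nonempty (b.carrier × Set.Icc (0 : ℝ) 1) :=
    ⟨(Classical.arbitrary _, ⟨0, left_mem_Icc.2 zero_le_one⟩)⟩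
  set u : EuclideanSpace ℝ (Fin n) := PiLp.single 2 (0 : Fin n) (1 : ℝ) with hu_def
  have hu : u ≠ 0 := by
    rw [hu_def, Ne, PiLp.single_eq_zero_iff]
    exact one_ne_zero
  have hV : ((u, 0) : TangentSpace ((𝓡 n).prod (𝓡∂ 1)) p) ≠ 0 := fun h ↦ hu (congrArg Prod.fst h)
  have h1 : 0 < pullbackBilin (I := 𝓡∂ (n + 1)) (I' := (𝓡 n).prod (𝓡∂ 1)) c g.val p
      ((u, 0) : TangentSpace ((𝓡 n).prod (𝓡∂ 1)) p) ((u, 0) : TangentSpace ((𝓡 n).prod (𝓡∂ 1)) p) :=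
    (isSpacelikeImmersion_of_isRiemannian hg c.isSmoothEmbedding).2 p _ hV
  have h2 : 0 < pullbackBilin (I := 𝓡∂ (n + 1)) (I' := 𝓡 n) b.incl g.val p.1 u u :=
    (isSpacelikeImmersion_of_isRiemannian hg b.isSmoothEmbedding).2 p.1 u hu
  rw [hc] at h1
  have h0 : (show EuclideanSpace ℝ (Fin 1) from
      ((u, 0) : TangentSpace ((𝓡 n).prod (𝓡∂ 1)) p).2) 0 = 0 := rfl
  rw [h0, mul_zero, mul_zero, zero_add] at h1
  exact (mul_pos_iff_of_pos_right h2).1 h1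

end Warping

/-! ### Gluing along an empty boundary: two disjoint pieces -/

section Disjoint

variable {E : Type u} [NormedAddCommGroup E] [NormedSpace ℝ E] [FiniteDimensional ℝ E]
  [CompleteSpace E]
  {H : Type*} [TopologicalSpace H] {I : ModelWithCorners ℝ E H}
  {H' : Type*} [TopologicalSpace H'] {J : ModelWithCorners ℝ E H'}
  {M : Type*} [TopologicalSpace M] [ChartedSpace H M] [IsManifold I ∞ M]
  {N : Type*} [TopologicalSpace N] [ChartedSpace H N] [IsManifold I ∞ N]
  {P : Type*} [TopologicalSpace P] [ChartedSpace H' P] [IsManifold J ∞ P]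

omit [IsManifold I ∞ M] [IsManifold I ∞ N] in
/-- An empty manifold carries (vacuously) a Riemannian metric of positive scalar curvature.
[folklore] -/
theorem exists_pscMetric_of_isEmpty [IsEmpty P] :
    ∃ g : PseudoRiemannianMetric J ∞ E (TangentSpace J : P → Type _), ∃ _ : g.HasLeviCivita,
      g.IsRiemannian ∧ ∀ x, 0 < g.scalarCurvature x := by
  refine ⟨⟨fun x ↦ isEmptyElim x, fun x ↦ isEmptyElim x, fun x ↦ isEmptyElim x,
    fun x ↦ isEmptyElim x⟩, ?_, fun x ↦ isEmptyElim x, fun x ↦ isEmptyElim x⟩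
  exact PseudoRiemannianMetric.hasLeviCivita _

/-- **Two disjoint compact pieces with positive scalar curvature give positive scalar curvature.**
If `P` is covered by smooth embeddings `jM : M → P`, `jN : N → P` of compact manifolds with
disjoint images (so both images are open and closed) and `M`, `N` carry Riemannian metrics of
positive scalar curvature, then so does `P`: transport the metrics to the open images
(`exists_pscMetric_on_openPiece`) and glue the two fields along the open cover
(`exists_pseudoRiemannianMetric_of_openCover`); the scalar curvature is computed on each open
piece by naturality (`scalarCurvature_comap`). [cite: ONeill1983, Ch. 3, Prop. 3.59] -/
theorem exists_pscMetric_of_disjoint_pieces [CompactSpace M] [CompactSpace N] [T2Space P]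
    {jM : M → P} {jN : N → P} (hjM : Manifold.IsSmoothEmbedding I J ∞ jM)
    (hjN : Manifold.IsSmoothEmbedding I J ∞ jN) (hcover : range jM ∪ range jN = univ)
    (hdisj : ∀ a b, jM a ≠ jN b)
    (gM : PseudoRiemannianMetric I ∞ E (TangentSpace I : M → Type _)) [gM.HasLeviCivita]
    (hgM : gM.IsRiemannian) (hSM : ∀ x, 0 < gM.scalarCurvature x)
    (gN : PseudoRiemannianMetric I ∞ E (TangentSpace I : N → Type _)) [gN.HasLeviCivita]
    (hgN : gN.IsRiemannian) (hSN : ∀ x, 0 < gN.scalarCurvature x) :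
    ∃ g : PseudoRiemannianMetric J ∞ E (TangentSpace J : P → Type _), ∃ _ : g.HasLeviCivita,
      g.IsRiemannian ∧ ∀ x, 0 < g.scalarCurvature x := by
  classical
  have hcM : IsClosed (range jM) := (isCompact_range hjM.isEmbedding.continuous).isClosed
  have hcN : IsClosed (range jN) := (isCompact_range hjN.isEmbedding.continuous).isClosed
  have hMN : range jM = (range jN)ᶜ := by
    ext x
    constructor
    · rintro ⟨a, rfl⟩ ⟨b, hb⟩
      exact hdisj a b hb.symm
    · intro hx
      have hx' : x ∈ range jM ∪ range jN := hcover ▸ mem_univ x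
      exact hx'.resolve_right hx
  have hNM : range jN = (range jM)ᶜ := by rw [hMN, compl_compl]
  have hoM : IsOpen (range jM) := by rw [hMN]; exact hcN.isOpen_compl
  have hoN : IsOpen (range jN) := by rw [hNM]; exact hcM.isOpen_compl
  set U : Bool → Opens P := fun i ↦ cond i ⟨range jM, hoM⟩ ⟨range jN, hoN⟩ with hU
  have hpiece : ∀ i, ∃ gU : PseudoRiemannianMetric J ∞ E (TangentSpace J : U i → Type _),
      ∃ _ : gU.HasLeviCivita, gU.IsRiemannian ∧ ∀ u, 0 < gU.scalarCurvature u := by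
    rintro (_ | _)
    · rcases isEmpty_or_nonempty N with hN | hN
      · haveI : IsEmpty (U false) := ⟨fun u ↦ by
          obtain ⟨b, -⟩ := (show (u : P) ∈ range jN from u.2)
          exact isEmptyElim b⟩
        exact exists_pscMetric_of_isEmpty
      · exact exists_pscMetric_on_openPiece hjN gN hgN hSN (U false) fun x hx ↦ hx
    · rcases isEmpty_or_nonempty M with hM | hM
      · haveI : IsEmpty (U true) := ⟨fun u ↦ by
          obtain ⟨a, -⟩ := (show (u : P) ∈ range jM from u.2)
          exact isEmptyElim a⟩
        exact exists_pscMetric_of_isEmpty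
      · exact exists_pscMetric_on_openPiece hjM gM hgM hSM (U true) fun x hx ↦ hx
  choose gU hlc hR hS using hpiece
  have hcov : ∀ x : P, ∃ i, x ∈ U i := fun x ↦ by
    have hx : x ∈ range jM ∪ range jN := hcover ▸ mem_univ x
    rcases hx with h | h
    · exact ⟨true, h⟩
    · exact ⟨false, h⟩
  have hcompat : ∀ i j (x : P) (hi : x ∈ U i) (hj : x ∈ U j),
      ((gU i).val ⟨x, hi⟩ : E →L[ℝ] E →L[ℝ] ℝ) = (gU j).val ⟨x, hj⟩ := by
    rintro (_ | _) (_ | _) x hi hj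
    · rfl
    · exfalso
      have hj' : x ∈ range jM := hj
      rw [hMN] at hj'
      exact hj' hi
    · exfalso
      have hi' : x ∈ range jM := hi
      rw [hMN] at hi'
      exact hi' hj
    · rfl
  obtain ⟨g, hg⟩ := OpenSubmanifold.exists_pseudoRiemannianMetric_of_openCover U hcov gU hcompat
  haveI hglc : g.HasLeviCivita := g.hasLeviCivita
  refine ⟨g, hglc, fun x v hv ↦ ?_, fun x ↦ ?_⟩
  · obtain ⟨i, hi⟩ := hcov x
    have h := DFunLike.congr_fun (DFunLike.congr_fun (hg i ⟨x, hi⟩) v) v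
    have h' : g.val x v v = (gU i).val ⟨x, hi⟩ v v := h
    rw [h']
    exact hR i ⟨x, hi⟩ v hv
  · obtain ⟨i, hi⟩ := hcov x
    have hinj : ∀ u : U i, Injective (mfderiv J J (Subtype.val : U i → P) u) := fun u ↦ by
      rw [OpenSubmanifold.mfderiv_subtype_val]
      exact fun a b h ↦ h
    obtain ⟨gQ, hQlc, hQval, -, hQs⟩ := exists_metric_comap_of_injective
      (Ψ := (Subtype.val : U i → P)) contMDiff_subtype_val hinj g
    have hv : ∀ u, gQ.val u = (gU i).val u := fun u ↦ by
      ext v w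
      rw [hQval, OpenSubmanifold.mfderiv_subtype_val]
      exact DFunLike.congr_fun (DFunLike.congr_fun (hg i u) v) w
    have h := hS i ⟨x, hi⟩
    rw [← scalarCurvature_congr_of_val_eq hv ⟨x, hi⟩, hQs] at h
    exact h

end Disjoint

end Literature.Geometry.Riemannian
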